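import Literature.Probability.Percolation.HutchcroftGammaLeDeltaSubOneHolds
import HarnessLib

/-!
# Hutchcroft 2020: the EXPONENTIAL subcritical volume tails (Thm 1.1, first bullet; the tail of Thm 1.2)

Source: T. Hutchcroft, *New critical exponent inequalities for percolation and the random cluster model*,
Probab. Math. Phys. 1 (2020) 147–165, arXiv:1901.10363, §4.1.  Two consequences of the integrated volume
differential inequality (eqs. (integrated1)/(integrated2), tree: `GhostExploration.real_clusterSizeGe_le_mul_exp`
of `HutchcroftVolumeTailSubcritical.lean`) for bond percolation on `ℤ^d`, `d ≥ 2`, `K = C(0)`, `ε = p_c − p`: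

* **Thm 1.1, first bullet** (`real_clusterSizeGe_le_exp_of_critical`): if `P_{p_c}(|K| ≥ n) ≤ C n^{−1/δ}` (`δ > 1`)
  then `P_p(|K| ≥ n) ≤ e·C·n^{−1/δ}·exp(−c₂ ε^δ n)` for all `0 < p < p_c`, `n ≥ 1` — the printed route: first
  `χ(p) ≲ ε^{−(δ−1)}` (eq. (4.1); tree: `Hutchcroft2020_gamma_le_delta_sub_one_holds`, arm of the same programme),
  then (integrated1) between `p` and `p₁ = (p + p_c)/2` with `Σ_n(p₁) ≤ χ(p₁)`;
* **the tail behind Thm 1.2** (`real_clusterSizeGe_le_of_chi_le`): if `χ(q) ≤ C (p_c − q)^{−γ}` for all `q < p_c` then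
  `P_p(|K| ≥ n) ≤ (e·2^γ·C·ε^{−γ}/n)·exp(−c₁ ε^{γ+1} n)`, `c₁ = (1 − e^{−1})/(2^γ C)` ((integrated2) + Markov);

with the Markov step `P_p(|K| ≥ n) ≤ χ(p)/n` (`real_clusterSizeGe_le_chi_div`) and `Σ_n(p) ≤ χ(p)`
(`volSum_le_chi`).  The moment bounds (Thm 1.1 second bullet for all `k`; Thm 1.2) are in
`HutchcroftMomentBounds.lean`.
-/

noncomputable section

namespace Literature.Probability.Percolation

open _root_.MeasureTheory Finset Literature.Probability.LatticeModels
open GhostExploration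

namespace HutchcroftMoments

variable {d : ℕ}

/-- `Σ_n(p) = ∑_{m=1}^n P_p(|K| ≥ m) ≤ χ(p)` below `p_c` (`d ≥ 2`).
[cite: Hutchcroft2020, §4.1 proof of Thm 1.2 (∑_{m ≤ n} P(|K| ≥ m) ≤ E|K|)] -/
theorem volSum_le_chi (hd : 2 ≤ d) (p : unitInterval) (hp : (p : ℝ) < criticalProbI d) (n : ℕ) :
    volSum d n p ≤ chi d p := by
  have hp' : (p : ℝ) < criticalProb (zdGraph d) (0 : Site d) := by rwa [← coe_criticalProbI]
  have h := ofReal_sum_real_clusterSizeGe_le (zdGraph d) (0 : Site d) p n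
  rw [expClusterSize_eq_ofReal_chi hd p hp'] at h
  have hχ0 : 0 ≤ chi d p := (zero_le_one.trans (one_le_chi hd p hp'))
  exact (ENNReal.ofReal_le_ofReal_iff hχ0).1 h

/-- MARKOV: `P_p(|K| ≥ n) ≤ χ(p)/n` below `p_c` (`n ≥ 1`, `d ≥ 2`), via `n P_p(|K| ≥ n) ≤ Σ_n(p) ≤ χ(p)`.
[cite: Hutchcroft2020, §4.1 proof of Thm 1.2 ("by (integrated2) and Markov's inequality")] -/
theorem real_clusterSizeGe_le_chi_div (hd : 2 ≤ d) (p : unitInterval) (hp : (p : ℝ) < criticalProbI d)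
    {n : ℕ} (hn : 1 ≤ n) :
    (bondPercolation (zdGraph d) p).real (clusterSizeGe (0 : Site d) n) ≤ chi d p / n := by
  have hn0 : (0 : ℝ) < n := by exact_mod_cast hn
  rw [le_div_iff₀ hn0]
  have hmono : (n : ℝ) * (bondPercolation (zdGraph d) p).real (clusterSizeGe (0 : Site d) n)
      ≤ volSum d n p := by
    unfold volSum
    calc (n : ℝ) * (bondPercolation (zdGraph d) p).real (clusterSizeGe (0 : Site d) n)
        = ∑ _m ∈ Finset.Icc 1 n, (bondPercolation (zdGraph d) p).real (clusterSizeGe (0 : Site d) n) := by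
          rw [Finset.sum_const, Nat.card_Icc, Nat.add_sub_cancel, nsmul_eq_mul]
      _ ≤ ∑ m ∈ Finset.Icc 1 n, (bondPercolation (zdGraph d) p).real (clusterSizeGe (0 : Site d) m) := by
          refine Finset.sum_le_sum fun m hm => ?_
          exact measureReal_mono (clusterSizeGe_antitone (0 : Site d) (Finset.mem_Icc.1 hm).2)
  calc (bondPercolation (zdGraph d) p).real (clusterSizeGe (0 : Site d) n) * n
      = (n : ℝ) * (bondPercolation (zdGraph d) p).real (clusterSizeGe (0 : Site d) n) := mul_comm _ _
    _ ≤ chi d p := hmono.trans (volSum_le_chi hd p hp n)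

/-- THE INTEGRATED INEQUALITY WITH `χ` (Hutchcroft's (integrated2), weak form): for `0 < p < t < p_c`,
`P_p(|K| ≥ n) ≤ (χ(t)/n) · exp(−(t − p)·[2(1−e^{−1}) n/χ(t) − 2])`.
[cite: Hutchcroft2020, §3 eq. (integrated2) and §4.1 proof of Thm 1.2] -/
theorem real_clusterSizeGe_le_chi_mul_exp (hd : 2 ≤ d) {n : ℕ} (hn : 1 ≤ n) {p t : ℝ} (hp : 0 < p)
    (hpt : p < t) (ht : t < criticalProbI d) :
    (bondPercolation (zdGraph d) (Set.projIcc 0 1 zero_le_one p)).real (clusterSizeGe (0 : Site d) n)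
      ≤ chi d (Set.projIcc 0 1 zero_le_one t) / n
        * Real.exp (-((t - p) * (2 * (1 - Real.exp (-1)) * n / chi d (Set.projIcc 0 1 zero_le_one t) - 2))) := by
  have hpc1 : (criticalProbI d : ℝ) ≤ 1 := (criticalProbI d).2.2
  have ht1 : t < 1 := ht.trans_le hpc1
  set tI : unitInterval := Set.projIcc 0 1 zero_le_one t with htI
  have htt : (tI : ℝ) = t := by rw [htI, Set.projIcc_of_mem _ ⟨(hp.trans hpt).le, ht1.le⟩]
  have htc : (tI : ℝ) < criticalProbI d := by rw [htt]; exact ht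
  have h1 := real_clusterSizeGe_le_mul_exp (d := d) hn hp hpt ht1
  have hχ1 : 1 ≤ chi d tI :=
    one_le_chi hd tI (by rw [← coe_criticalProbI]; exact htc)
  have hχ0 : 0 < chi d tI := by linarith
  have hS1 : 1 ≤ volSum d n tI := one_le_volSum hn tI
  have hSχ : volSum d n tI ≤ chi d tI := volSum_le_chi hd tI htc n
  -- compare the exponents
  have hexp : Real.exp (-(2 * (t - p) * ((1 - Real.exp (-1)) * n / volSum d n tI - 1)))
      ≤ Real.exp (-((t - p) * (2 * (1 - Real.exp (-1)) * n / chi d tI - 2))) := by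
    rw [Real.exp_le_exp, neg_le_neg_iff]
    have hc : (1 - Real.exp (-1)) * n / chi d tI ≤ (1 - Real.exp (-1)) * n / volSum d n tI :=
      div_le_div_of_nonneg_left (mul_nonneg (by linarith [Real.exp_lt_one_iff.2 (show (-1 : ℝ) < 0 by norm_num)])
        (Nat.cast_nonneg n)) (by linarith) hSχ
    have htp : 0 ≤ t - p := by linarith
    calc (t - p) * (2 * (1 - Real.exp (-1)) * n / chi d tI - 2)
        = 2 * (t - p) * ((1 - Real.exp (-1)) * n / chi d tI - 1) := by ring
      _ ≤ 2 * (t - p) * ((1 - Real.exp (-1)) * n / volSum d n tI - 1) :=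
          mul_le_mul_of_nonneg_left (by linarith) (by linarith)
  calc (bondPercolation (zdGraph d) (Set.projIcc 0 1 zero_le_one p)).real (clusterSizeGe (0 : Site d) n)
      ≤ (bondPercolation (zdGraph d) tI).real (clusterSizeGe (0 : Site d) n)
          * Real.exp (-(2 * (t - p) * ((1 - Real.exp (-1)) * n / volSum d n tI - 1))) := h1
    _ ≤ chi d tI / n * Real.exp (-((t - p) * (2 * (1 - Real.exp (-1)) * n / chi d tI - 2))) :=
        mul_le_mul (real_clusterSizeGe_le_chi_div hd tI htc hn) hexp (Real.exp_pos _).le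
          (div_nonneg hχ0.le (Nat.cast_nonneg n))

/-- **The tail behind Theorem 1.2** (`Δ ≤ γ + 1`): if `χ(q) ≤ C (p_c − q)^{−γ}` for every `q < p_c` (`C > 0`,
any real `γ`), then for `0 < p < p_c`, `n ≥ 1`, with `ε = p_c − p`,
`P_p(|K| ≥ n) ≤ (e · 2^γ · C · ε^{−γ} / n) · exp(−((1−e^{−1})/(2^γ C)) · ε^{γ+1} · n)`
(Hutchcroft: "`⪯ (β₀−β)^{−γ} n^{−1} exp[−c₂ (β₁−β₀)^{γ+1} n]`", `p₁ = (p + p_c)/2`).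
[cite: Hutchcroft2020, §4.1 proof of Thm 1.2 (the display with p₁ = (p₀ + p)/2)] -/
theorem real_clusterSizeGe_le_of_chi_le (hd : 2 ≤ d) {C γ : ℝ} (hC : 0 < C)
    (hχ : ∀ q : unitInterval, (q : ℝ) < criticalProbI d →
      chi d q ≤ C * ((criticalProbI d : ℝ) - q) ^ (-γ))
    (p : unitInterval) (hp0 : 0 < (p : ℝ)) (hp : (p : ℝ) < criticalProbI d) {n : ℕ} (hn : 1 ≤ n) :
    (bondPercolation (zdGraph d) p).real (clusterSizeGe (0 : Site d) n)
      ≤ Real.exp 1 * 2 ^ γ * C * ((criticalProbI d : ℝ) - p) ^ (-γ) / n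
        * Real.exp (-((1 - Real.exp (-1)) / (2 ^ γ * C) * ((criticalProbI d : ℝ) - p) ^ (γ + 1) * n)) := by
  set pc : ℝ := (criticalProbI d : ℝ) with hpc
  set ε : ℝ := pc - p with hε
  have hε0 : 0 < ε := by rw [hε]; linarith
  have hε1 : ε ≤ 1 := by
    have : pc ≤ 1 := (criticalProbI d).2.2
    have : 0 ≤ (p : ℝ) := p.2.1
    rw [hε]; linarith
  set t : ℝ := ((p : ℝ) + pc) / 2 with ht
  have hpt : (p : ℝ) < t := by rw [ht]; linarith
  have htc : t < pc := by rw [ht]; linarith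
  have htp : t - p = ε / 2 := by rw [ht, hε]; ring
  have hct : pc - t = ε / 2 := by rw [ht, hε]; ring
  -- the integrated inequality between `p` and `t`
  have h1 := real_clusterSizeGe_le_chi_mul_exp hd hn hp0 hpt htc
  have hpproj : Set.projIcc 0 1 zero_le_one (p : ℝ) = p := Set.projIcc_val zero_le_one p
  rw [hpproj] at h1
  set tI : unitInterval := Set.projIcc 0 1 zero_le_one t with htI
  have ht1 : t < 1 := htc.trans_le (criticalProbI d).2.2
  have htt : (tI : ℝ) = t := by rw [htI, Set.projIcc_of_mem _ ⟨(hp0.trans hpt).le, ht1.le⟩]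
  have htIc : (tI : ℝ) < criticalProbI d := by rw [htt]; exact htc
  have hχ1 : 1 ≤ chi d tI := one_le_chi hd tI (by rw [← coe_criticalProbI]; exact htIc)
  have hχ0 : 0 < chi d tI := by linarith
  -- `χ(t) ≤ C (ε/2)^{−γ} = 2^γ C ε^{−γ}`
  have hχt : chi d tI ≤ 2 ^ γ * C * ε ^ (-γ) := by
    have := hχ tI htIc
    rw [htt, hct] at this
    calc chi d tI ≤ C * (ε / 2) ^ (-γ) := this
      _ = 2 ^ γ * C * ε ^ (-γ) := by
          rw [Real.div_rpow hε0.le zero_le_two, Real.rpow_neg zero_le_two, div_inv_eq_mul]; ring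
  have hB0 : 0 < 2 ^ γ * C * ε ^ (-γ) := by positivity
  have hn0 : (0 : ℝ) < n := by exact_mod_cast hn
  have he1 : 0 < 1 - Real.exp (-1) := by linarith [Real.exp_lt_one_iff.2 (show (-1 : ℝ) < 0 by norm_num)]
  -- exponent comparison
  have hexp : Real.exp (-((t - p) * (2 * (1 - Real.exp (-1)) * n / chi d tI - 2)))
      ≤ Real.exp 1 * Real.exp (-((1 - Real.exp (-1)) / (2 ^ γ * C) * ε ^ (γ + 1) * n)) := by
    rw [← Real.exp_add, Real.exp_le_exp, htp]
    have hq : (1 - Real.exp (-1)) * n / (2 ^ γ * C * ε ^ (-γ)) ≤ (1 - Real.exp (-1)) * n / chi d tI :=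
      div_le_div_of_nonneg_left (mul_nonneg he1.le hn0.le) hχ0 hχt
    have hid : (1 - Real.exp (-1)) / (2 ^ γ * C) * ε ^ (γ + 1) * n
        = ε * ((1 - Real.exp (-1)) * n / (2 ^ γ * C * ε ^ (-γ))) := by
      rw [Real.rpow_add hε0, Real.rpow_one, Real.rpow_neg hε0.le]
      field_simp
    rw [hid]
    have key := mul_le_mul_of_nonneg_left hq hε0.le
    have e1 : ε / 2 * (2 * (1 - Real.exp (-1)) * n / chi d tI - 2)
        = ε * ((1 - Real.exp (-1)) * n / chi d tI) - ε := by ring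
    rw [e1]
    linarith
  calc (bondPercolation (zdGraph d) p).real (clusterSizeGe (0 : Site d) n)
      ≤ chi d tI / n * Real.exp (-((t - p) * (2 * (1 - Real.exp (-1)) * n / chi d tI - 2))) := h1
    _ ≤ (2 ^ γ * C * ε ^ (-γ) / n)
        * (Real.exp 1 * Real.exp (-((1 - Real.exp (-1)) / (2 ^ γ * C) * ε ^ (γ + 1) * n))) :=
        mul_le_mul (div_le_div_of_nonneg_right hχt hn0.le) hexp (Real.exp_pos _).le
          (div_nonneg hB0.le hn0.le)
    _ = _ := by ring

/-- **Theorem 1.1, first bullet (pure exponential subcritical volume tail)**, bond percolation on `ℤ^d`, `d ≥ 2`: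
if `P_{p_c}(|K| ≥ n) ≤ C n^{−1/δ}` for all `n ≥ 1` (`δ > 1`), then there is `c > 0` with
`P_p(|K| ≥ n) ≤ e · C · n^{−1/δ} · exp(−c (p_c − p)^δ n)` for all `0 < p < p_c`, `n ≥ 1`
(the printed `C' n^{−1/δ} exp[−c(p_c−p)^δ n]`).  Route of §4.1: `χ ≲ (p_c−p)^{−(δ−1)}` (tree:
`Hutchcroft2020_gamma_le_delta_sub_one_holds`), then (integrated1) between `p` and `(p + p_c)/2`.
[cite: Hutchcroft2020, Thm 1.1 (first bullet)] -/
theorem real_clusterSizeGe_le_exp_of_critical (hd : 2 ≤ d) {C δ : ℝ} (hδ : 1 < δ)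
    (hC : ∀ n : ℕ, 1 ≤ n →
      (bondPercolation (zdGraph d) (criticalProbI d)).real (clusterSizeGe (0 : Site d) n) ≤ C * (n : ℝ) ^ (-(1 / δ))) :
    ∃ c : ℝ, 0 < c ∧ ∀ p : unitInterval, 0 < (p : ℝ) → (p : ℝ) < criticalProbI d → ∀ n : ℕ, 1 ≤ n →
      (bondPercolation (zdGraph d) p).real (clusterSizeGe (0 : Site d) n)
        ≤ Real.exp 1 * C * (n : ℝ) ^ (-(1 / δ)) * Real.exp (-(c * ((criticalProbI d : ℝ) - p) ^ δ * n)) := by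
  obtain ⟨C'', hC''0, hχ⟩ := Hutchcroft2020_gamma_le_delta_sub_one_holds d (by omega) C δ hδ hC
  have he1 : 0 < 1 - Real.exp (-1) := by linarith [Real.exp_lt_one_iff.2 (show (-1 : ℝ) < 0 by norm_num)]
  refine ⟨(1 - Real.exp (-1)) / (2 * C'') ^ (δ - 1), by positivity, fun p hp0 hp n hn => ?_⟩
  set pc : ℝ := (criticalProbI d : ℝ) with hpc
  set ε : ℝ := pc - p with hε
  have hε0 : 0 < ε := by rw [hε]; linarith
  have hε1 : ε ≤ 1 := by
    have : pc ≤ 1 := (criticalProbI d).2.2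
    have : 0 ≤ (p : ℝ) := p.2.1
    rw [hε]; linarith
  set t : ℝ := ((p : ℝ) + pc) / 2 with ht
  have hpt : (p : ℝ) < t := by rw [ht]; linarith
  have htc : t < pc := by rw [ht]; linarith
  have ht1 : t < 1 := htc.trans_le (criticalProbI d).2.2
  have htp : t - p = ε / 2 := by rw [ht, hε]; ring
  have hct : pc - t = ε / 2 := by rw [ht, hε]; ring
  set tI : unitInterval := Set.projIcc 0 1 zero_le_one t with htI
  have htt : (tI : ℝ) = t := by rw [htI, Set.projIcc_of_mem _ ⟨(hp0.trans hpt).le, ht1.le⟩]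
  have htIc : (tI : ℝ) < criticalProbI d := by rw [htt]; exact htc
  -- (integrated1) between `p` and `t`
  have h1 := real_clusterSizeGe_le_mul_exp (d := d) hn hp0 hpt ht1
  rw [Set.projIcc_val zero_le_one p] at h1
  have hS1 : 1 ≤ volSum d n tI := one_le_volSum hn tI
  have hSχ : volSum d n tI ≤ chi d tI := volSum_le_chi hd tI htIc n
  -- `χ(t) ≤ (C''/(ε/2))^{δ−1} = (2C'')^{δ−1} ε^{−(δ−1)}`
  have hχt : chi d tI ≤ (2 * C'') ^ (δ - 1) * ε ^ (-(δ - 1)) := by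
    have := hχ tI htIc
    rw [htt, hct] at this
    calc chi d tI ≤ (C'' / (ε / 2)) ^ (δ - 1) := this
      _ = (2 * C'') ^ (δ - 1) * ε ^ (-(δ - 1)) := by
          rw [show C'' / (ε / 2) = (2 * C'') * ε⁻¹ by field_simp, Real.mul_rpow (by positivity)
            (inv_nonneg.2 hε0.le), Real.inv_rpow hε0.le, Real.rpow_neg hε0.le]
  have hB0 : 0 < (2 * C'') ^ (δ - 1) * ε ^ (-(δ - 1)) := by positivity
  -- `P_t(|K| ≥ n) ≤ P_{p_c}(|K| ≥ n) ≤ C n^{−1/δ}`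
  have hPt : (bondPercolation (zdGraph d) tI).real (clusterSizeGe (0 : Site d) n) ≤ C * (n : ℝ) ^ (-(1 / δ)) :=
    (real_clusterSizeGe_mono_param (Subtype.coe_le_coe.1 (by rw [htt]; exact htc.le)) 0 n).trans (hC n hn)
  have hCn0 : 0 ≤ C * (n : ℝ) ^ (-(1 / δ)) := measureReal_nonneg.trans hPt
  have hn0 : (0 : ℝ) < n := by exact_mod_cast hn
  -- exponent comparison
  have hexp : Real.exp (-(2 * (t - p) * ((1 - Real.exp (-1)) * n / volSum d n tI - 1)))
      ≤ Real.exp 1 * Real.exp (-((1 - Real.exp (-1)) / (2 * C'') ^ (δ - 1) * ε ^ δ * n)) := by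
    rw [← Real.exp_add, Real.exp_le_exp, htp]
    have hq : (1 - Real.exp (-1)) * n / ((2 * C'') ^ (δ - 1) * ε ^ (-(δ - 1)))
        ≤ (1 - Real.exp (-1)) * n / volSum d n tI :=
      div_le_div_of_nonneg_left (mul_nonneg he1.le hn0.le) (by linarith) (hSχ.trans hχt)
    have hid : (1 - Real.exp (-1)) / (2 * C'') ^ (δ - 1) * ε ^ δ * n
        = ε * ((1 - Real.exp (-1)) * n / ((2 * C'') ^ (δ - 1) * ε ^ (-(δ - 1)))) := by
      have : ε ^ δ = ε * ε ^ (δ - 1) := by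
        rw [← Real.rpow_one_add' hε0.le (by linarith), add_sub_cancel]
      rw [this, Real.rpow_neg hε0.le]
      field_simp
    rw [hid]
    have key := mul_le_mul_of_nonneg_left hq hε0.le
    have e1 : 2 * (ε / 2) * ((1 - Real.exp (-1)) * n / volSum d n tI - 1)
        = ε * ((1 - Real.exp (-1)) * n / volSum d n tI) - ε := by ring
    rw [e1]
    linarith
  calc (bondPercolation (zdGraph d) p).real (clusterSizeGe (0 : Site d) n)
      ≤ (bondPercolation (zdGraph d) tI).real (clusterSizeGe (0 : Site d) n)
          * Real.exp (-(2 * (t - p) * ((1 - Real.exp (-1)) * n / volSum d n tI - 1))) := h1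
    _ ≤ (C * (n : ℝ) ^ (-(1 / δ)))
        * (Real.exp 1 * Real.exp (-((1 - Real.exp (-1)) / (2 * C'') ^ (δ - 1) * ε ^ δ * n))) :=
        mul_le_mul hPt hexp (Real.exp_pos _).le hCn0
    _ = _ := by ring

end HutchcroftMoments

end Literature.Probability.Percolation
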